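import Mathlib
import Summits.Ventures.PercRepro2.SwOutMultiRootKinds

/-!
# The multi-root core cube: the two parts at a non-escaping side point (blind cell PercRepro2,
night-4 g34, 2026-08-29; proofs/NIGHT4-G34.md §6)

A region `U ∋ h`, `l ∉ U`, roots `R` (no loop at a root), every other
vertex of `U` exempt (forced into `C_R(l)`), in `X` (loops only), with an outside edge, or
isolated.  At a side point `ζ` whose roots are NON-ESCAPING (`hull ζ r ⊆ U` for every root) the red
and the blue part of the extended hull are disjoint and joined by no edge
(`redPartR_disjoint_bluePartR`, `no_edge_redPartR_bluePartR`: the argument of g13's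
`redExt_disjoint_blueExt`), every arm lies in one part, every non-root vertex of the extended
hull has its arm among `armsR` (the last root of a monochromatic path from a root), the base
agrees with `ζ` inside a red arm and with `blue ζ` inside a blue arm, and every vertex of a part is
connected inside its arm to a root in the colour of the part (`exists_root_conn_inside_red`,
`exists_root_conn_inside_blue`).
-/

namespace Summit.Ventures.PercRepro2

namespace LocRows

open Hull

variable {V : Type*} {E : Type*}

open scoped Classical

variable {ends : E → Sym2 V}

section NonEscaping

variable [Fintype E] [DecidableEq E] {U : Set V} {ξ : Config E} {l h : V} {R : Set V}
  {𝓤 𝓓 𝓓'' : Set (Set V)} {X : Set V} {𝓤' : Set (Set V)} {F : V → Prop} {ζ : Config E}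
  (hl : l ∉ U) (hloop : ∀ e r, r ∈ R → ends e ≠ s(r, r))
  (hF : ∀ x, F x → ∀ S ∈ 𝓤, x ∈ S)
  (hout : ∀ x ∈ U, x ∉ R →
    F x ∨ x ∈ X ∨ (∃ e y, ends e = s(x, y) ∧ y ∉ U) ∨ (∀ e, x ∉ ends e))
  (hX : ∀ x ∈ X, x ∈ U → ∀ e, x ∈ ends e → ends e = s(x, x))
  (hζ : ζ ∈ gOutSide ends l h 𝓤 𝓓 𝓓'' X 𝓤' U ξ)
  (hne : ∀ r ∈ R, hull ends ζ r ⊆ U)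
include hne

omit [Fintype E] [DecidableEq E] in
/-- The extended hull of non-escaping roots lies in `U`. -/
lemma extHullR_subset_U : extHullR ends R ζ ⊆ U := by
  rintro x ⟨r, hr, hx⟩
  exact hne r hr hx

omit [Fintype E] [DecidableEq E] in
include hl in
/-- A non-escaping root is in no cluster of `l`. -/
lemma root_notMem_cluster_l {r : V} (hr : r ∈ R) :
    r ∉ cluster ends ζ l ∧ r ∉ cluster ends (blue ζ) l := by
  constructor
  · intro h'
    exact hl (hne r hr (Or.inl (conn_symm h')))
  · intro h'
    exact hl (hne r hr (Or.inr (conn_symm h')))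

include hl hF hout hX hζ in
/-- **The red and the blue part are disjoint** at a non-escaping side point. -/
theorem redPartR_disjoint_bluePartR {x : V} (hxr : x ∈ redPartR ends R ζ)
    (hxb : x ∈ bluePartR ends R ζ) : False := by
  obtain ⟨⟨r, hr, hx⟩, hxR⟩ := hxr
  obtain ⟨⟨r', hr', hx'⟩, -⟩ := hxb
  have hxU : x ∈ U := hne r hr (Or.inl hx)
  have hxr : x ≠ r := fun h' => hxR (h' ▸ hr)
  rcases hout x hxU hxR with hf | hxX | ⟨e, y, hxy, hyU⟩ | hiso
  · -- forced into `C_R(l)`: then the root `r` meets `C_R(l)`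
    have hA := (mem_gTypedQ.1 (mem_gOutSide.1 hζ).1).2.1
    have hxl : x ∈ cluster ends ζ l := hF x hf _ hA
    exact (root_notMem_cluster_l hl hne hr).1 (conn_trans hxl (conn_symm hx))
  · exact notMem_cluster_of_selfLoops hxr (hX x hxX hxU) hx
  · cases he : ζ e with
    | true => exact hyU (hne r hr (Or.inl (mem_cluster_of_edge hx he hxy)))
    | false =>
      have he' : blue ζ e = true := by rw [blue_eq_true_iff]; exact he
      exact hyU (hne r' hr' (Or.inr (mem_cluster_of_edge hx' he' hxy)))
  · obtain ⟨e, hxe⟩ := exists_edge_of_mem_cluster (h := r) hx hxr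
    exact hiso e hxe

include hl hF hout hX hζ in
/-- **No edge joins the red part to the blue part.** -/
theorem no_edge_redPartR_bluePartR {e : E} {x y : V} (hxy : ends e = s(x, y))
    (hx : x ∈ redPartR ends R ζ) (hy : y ∈ bluePartR ends R ζ) : False := by
  obtain ⟨⟨r, hr, hx'⟩, hxR⟩ := hx
  obtain ⟨⟨r', hr', hy'⟩, hyR⟩ := hy
  cases he : ζ e with
  | true =>
    exact redPartR_disjoint_bluePartR hl hF hout hX hζ hne
      ⟨⟨r, hr, mem_cluster_of_edge hx' he hxy⟩, hyR⟩ ⟨⟨r', hr', hy'⟩, hyR⟩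
  | false =>
    have he' : blue ζ e = true := by rw [blue_eq_true_iff]; exact he
    exact redPartR_disjoint_bluePartR hl hF hout hX hζ hne ⟨⟨r, hr, hx'⟩, hxR⟩
      ⟨⟨r', hr', mem_cluster_of_edge hy' he' (ends_swap hxy)⟩, hxR⟩

include hl hF hout hX hζ in
/-- The arm of a red-part vertex lies in the red part. -/
theorem armR_subset_redPartR {x : V} (hx : x ∈ redPartR ends R ζ) :
    armR ends R ζ x ⊆ redPartR ends R ζ := by
  intro y hy
  refine mem_of_conn_of_closed (ends := ends) (ω := armConfigR ends R ζ) ?_ hx hy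
  intro a ha b hab
  obtain ⟨-, e, he, hab'⟩ := exists_edge_of_adj hab
  simp only [armConfigR, decide_eq_true_eq] at he
  obtain ⟨p, hp, q, hq, hpq⟩ := he
  have hbH : b ∈ extHullR ends R ζ \ R := by
    rw [hab', Sym2.eq_iff] at hpq
    rcases hpq with ⟨rfl, rfl⟩ | ⟨rfl, rfl⟩
    · exact hq
    · exact hp
  rcases mem_redPartR_or_bluePartR hbH.1 hbH.2 with hb' | hb'
  · exact hb'
  · exact absurd hb' (fun hb'' => no_edge_redPartR_bluePartR hl hF hout hX hζ hne hab' ha hb'')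

include hl hF hout hX hζ in
/-- The arm of a blue-part vertex lies in the blue part. -/
theorem armR_subset_bluePartR {x : V} (hx : x ∈ bluePartR ends R ζ) :
    armR ends R ζ x ⊆ bluePartR ends R ζ := by
  intro y hy
  refine mem_of_conn_of_closed (ends := ends) (ω := armConfigR ends R ζ) ?_ hx hy
  intro a ha b hab
  obtain ⟨-, e, he, hab'⟩ := exists_edge_of_adj hab
  simp only [armConfigR, decide_eq_true_eq] at he
  obtain ⟨p, hp, q, hq, hpq⟩ := he
  have hbH : b ∈ extHullR ends R ζ \ R := by
    rw [hab', Sym2.eq_iff] at hpq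
    rcases hpq with ⟨rfl, rfl⟩ | ⟨rfl, rfl⟩
    · exact hq
    · exact hp
  rcases mem_redPartR_or_bluePartR hbH.1 hbH.2 with hb' | hb'
  · exact absurd hb' (fun hb'' =>
      no_edge_redPartR_bluePartR hl hF hout hX hζ hne (ends_swap hab') hb'' ha)
  · exact hb'

omit hne in
/-- Every non-root vertex of the red cluster of a root has its arm among the arms (the last root
on a red path from the root, and the arm of the next vertex). -/
theorem armR_mem_armsR_of_mem_cluster {r x : V} (hr : r ∈ R) (hx : x ∈ cluster ends ζ r)
    (hxR : x ∉ R) : armR ends R ζ x ∈ armsR ends R ζ := by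
  have key : x ∈ {y | y ∈ cluster ends ζ r ∧ (y ∈ R ∨ armR ends R ζ y ∈ armsR ends R ζ)} := by
    refine mem_of_conn_of_closed (ends := ends) (ω := ζ) ?_ ⟨mem_cluster_self _ _ _, Or.inl hr⟩ hx
    rintro y ⟨hy, hy'⟩ z hyz
    obtain ⟨-, e, he, hyz'⟩ := exists_edge_of_adj hyz
    have hz : z ∈ cluster ends ζ r := mem_cluster_of_edge hy he hyz'
    refine ⟨hz, ?_⟩
    by_cases hzR : z ∈ R
    · exact Or.inl hzR
    by_cases hyR : y ∈ R
    · exact Or.inr (armR_mem_armsR hyR hyz' hzR)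
    · have hya : armR ends R ζ y ∈ armsR ends R ζ := by
        rcases hy' with h' | h'
        · exact absurd h' hyR
        · exact h'
      have hyH : y ∈ extHullR ends R ζ \ R := ⟨⟨r, hr, Or.inl hy⟩, hyR⟩
      have hzH : z ∈ extHullR ends R ζ \ R := ⟨⟨r, hr, Or.inl hz⟩, hzR⟩
      rw [armR_eq_of_edge hyz' hyH hzH]
      exact Or.inr hya
  rcases key.2 with hxR' | h'
  · exact absurd hxR' hxR
  · exact h'

omit hne in
/-- Every non-root vertex of the blue cluster of a root has its arm among the arms. -/
theorem armR_mem_armsR_of_mem_cluster_blue {r x : V} (hr : r ∈ R)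
    (hx : x ∈ cluster ends (blue ζ) r) (hxR : x ∉ R) : armR ends R ζ x ∈ armsR ends R ζ := by
  have key : x ∈ {y | y ∈ cluster ends (blue ζ) r ∧ (y ∈ R ∨ armR ends R ζ y ∈ armsR ends R ζ)} := by
    refine mem_of_conn_of_closed (ends := ends) (ω := blue ζ) ?_
      ⟨mem_cluster_self _ _ _, Or.inl hr⟩ hx
    rintro y ⟨hy, hy'⟩ z hyz
    obtain ⟨-, e, he, hyz'⟩ := exists_edge_of_adj hyz
    have hz : z ∈ cluster ends (blue ζ) r := mem_cluster_of_edge hy he hyz'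
    refine ⟨hz, ?_⟩
    by_cases hzR : z ∈ R
    · exact Or.inl hzR
    by_cases hyR : y ∈ R
    · exact Or.inr (armR_mem_armsR hyR hyz' hzR)
    · have hya : armR ends R ζ y ∈ armsR ends R ζ := by
        rcases hy' with h' | h'
        · exact absurd h' hyR
        · exact h'
      have hyH : y ∈ extHullR ends R ζ \ R := ⟨⟨r, hr, Or.inr hy⟩, hyR⟩
      have hzH : z ∈ extHullR ends R ζ \ R := ⟨⟨r, hr, Or.inr hz⟩, hzR⟩
      rw [armR_eq_of_edge hyz' hyH hzH]
      exact Or.inr hya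
  rcases key.2 with hxR' | h'
  · exact absurd hxR' hxR
  · exact h'

omit hne in
/-- Every non-root vertex of the extended hull has its arm among the arms. -/
theorem armR_mem_armsR_of_mem_extHullR {x : V} (hx : x ∈ extHullR ends R ζ) (hxR : x ∉ R) :
    armR ends R ζ x ∈ armsR ends R ζ := by
  obtain ⟨r, hr, hx | hx⟩ := hx
  · exact armR_mem_armsR_of_mem_cluster hr hx hxR
  · exact armR_mem_armsR_of_mem_cluster_blue hr hx hxR

/-! ### The base is a multi-root base -/

include hl hF hout hX hζ in
/-- An edge with an end in the red part is untouched by the base flip. -/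
lemma baseR_apply_of_red {e : E} {x y : V} (hxy : ends e = s(x, y)) (hx : x ∈ redPartR ends R ζ) :
    baseR ends R ζ e = ζ e := by
  unfold baseR
  rw [flip_apply_of_notMem]
  rintro ⟨z, hz, w, hzw⟩
  rw [hxy, Sym2.eq_iff] at hzw
  rcases hzw with ⟨rfl, rfl⟩ | ⟨rfl, rfl⟩
  · exact redPartR_disjoint_bluePartR hl hF hout hX hζ hne hx hz
  · exact no_edge_redPartR_bluePartR hl hF hout hX hζ hne hxy hx hz

omit [Fintype E] [DecidableEq E] hne in
/-- An edge with an end in the blue part is flipped by the base flip. -/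
lemma baseR_apply_of_blue {e : E} {x y : V} (hxy : ends e = s(x, y)) (hx : x ∈ bluePartR ends R ζ) :
    baseR ends R ζ e = !ζ e := by
  unfold baseR
  rw [flip_apply_of_mem ⟨x, hx, y, hxy⟩]

omit [Fintype E] [DecidableEq E] hne in
/-- A vertex adjacent to a root lies in the hull of that root. -/
lemma mem_hull_of_adj_root {e : E} {r y : V} (hry : ends e = s(r, y)) : y ∈ hull ends ζ r := by
  cases he : ζ e with
  | true => exact Or.inl (mem_cluster_of_edge (mem_cluster_self _ _ _) he hry)
  | false =>
    have he' : blue ζ e = true := by rw [blue_eq_true_iff]; exact he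
    exact Or.inr (mem_cluster_of_edge (mem_cluster_self _ _ _) he' hry)

omit hne in
/-- Every arm of the family is the arm of a non-root vertex of the extended hull. -/
lemma exists_of_mem_armsR {P : Set V} (hP : P ∈ armsR ends R ζ) :
    ∃ y, y ∈ extHullR ends R ζ ∧ y ∉ R ∧ P = armR ends R ζ y := by
  obtain ⟨e, he, rfl⟩ := Finset.mem_image.1 hP
  simp only [rootEdgesR, Finset.mem_filter, Finset.mem_univ, true_and] at he
  obtain ⟨r, hr, y, hry, hyR⟩ := he
  exact ⟨y, ⟨r, hr, mem_hull_of_adj_root hry⟩, hyR, armOfEdgeR_eq hr hry hyR⟩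

include hl hF hout hX hζ in
/-- Every arm lies in the red part or in the blue part. -/
lemma armsR_subset_part {P : Set V} (hP : P ∈ armsR ends R ζ) :
    P ⊆ redPartR ends R ζ ∨ P ⊆ bluePartR ends R ζ := by
  obtain ⟨y, hyH, hyR, rfl⟩ := exists_of_mem_armsR hP
  rcases mem_redPartR_or_bluePartR hyH hyR with hy | hy
  · exact Or.inl (armR_subset_redPartR hl hF hout hX hζ hne hy)
  · exact Or.inr (armR_subset_bluePartR hl hF hout hX hζ hne hy)

include hl hloop hF hout hX hζ in
/-- Inside a red arm together with a root, the base agrees with `ζ`. -/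
lemma insideConfig_baseR_of_red {P : Set V} (hP : P ⊆ redPartR ends R ζ) {r : V} (hr : r ∈ R) :
    insideConfig ends (P ∪ {r}) (baseR ends R ζ) = insideConfig ends (P ∪ {r}) ζ := by
  funext e
  simp only [insideConfig]
  by_cases he : e ∈ within ends (P ∪ {r})
  · obtain ⟨x, hx, y, hy, hxy⟩ := he
    rcases hx with hx | hx
    · rw [baseR_apply_of_red hl hF hout hX hζ hne hxy (hP hx)]
    · rcases hy with hy | hy
      · rw [baseR_apply_of_red hl hF hout hX hζ hne (ends_swap hxy) (hP hy)]
      · rw [Set.mem_singleton_iff] at hx hy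
        rcases hx with rfl; rcases hy with rfl
        exact absurd hxy (hloop e _ hr)
  · rw [decide_eq_false he, Bool.and_false, Bool.and_false]

omit [Fintype E] [DecidableEq E] hne in
include hloop in
/-- Inside a blue arm together with a root, the base agrees with the blue colouring `blue ζ`. -/
lemma insideConfig_baseR_of_blue {P : Set V} (hP : P ⊆ bluePartR ends R ζ) {r : V} (hr : r ∈ R) :
    insideConfig ends (P ∪ {r}) (baseR ends R ζ) = insideConfig ends (P ∪ {r}) (blue ζ) := by
  funext e
  simp only [insideConfig]
  by_cases he : e ∈ within ends (P ∪ {r})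
  · obtain ⟨x, hx, y, hy, hxy⟩ := he
    rcases hx with hx | hx
    · rw [baseR_apply_of_blue hxy (hP hx), blue_apply]
    · rcases hy with hy | hy
      · rw [baseR_apply_of_blue (ends_swap hxy) (hP hy), blue_apply]
      · rw [Set.mem_singleton_iff] at hx hy
        rcases hx with rfl; rcases hy with rfl
        exact absurd hxy (hloop e _ hr)
  · rw [decide_eq_false he, Bool.and_false, Bool.and_false]

omit [Fintype E] [DecidableEq E] hne in
/-- **Every red-part vertex is red-connected inside its arm to a root** (the last root of a red
path from a root, followed by the vertex's arm). -/
theorem exists_root_conn_inside_red {x : V} (hx : x ∈ redPartR ends R ζ) :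
    ∃ r ∈ R, x ∈ cluster ends (insideConfig ends (armR ends R ζ x ∪ {r}) ζ) r := by
  obtain ⟨⟨r₀, hr₀, hx₀⟩, hxR⟩ := hx
  have key : x ∈ {y | y ∈ cluster ends ζ r₀ ∧ (y ∈ R ∨ ∃ r ∈ R,
      y ∈ cluster ends (insideConfig ends (armR ends R ζ y ∪ {r}) ζ) r)} := by
    refine mem_of_conn_of_closed (ends := ends) (ω := ζ) ?_ ⟨mem_cluster_self _ _ _, Or.inl hr₀⟩ hx₀
    rintro y ⟨hy, hy'⟩ z hyz
    obtain ⟨-, e, he, hyz'⟩ := exists_edge_of_adj hyz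
    have hz : z ∈ cluster ends ζ r₀ := mem_cluster_of_edge hy he hyz'
    refine ⟨hz, ?_⟩
    by_cases hzR : z ∈ R
    · exact Or.inl hzR
    by_cases hyR : y ∈ R
    · refine Or.inr ⟨y, hyR, ?_⟩
      have he' : insideConfig ends (armR ends R ζ z ∪ {y}) ζ e = true := by
        rw [insideConfig_eq_true_iff]
        exact ⟨he, y, Or.inr rfl, z, Or.inl (mem_armR_self z), hyz'⟩
      exact mem_cluster_of_edge (mem_cluster_self _ _ _) he' hyz'
    · obtain ⟨r, hr, hyr⟩ : ∃ r ∈ R, y ∈ cluster ends (insideConfig ends (armR ends R ζ y ∪ {r}) ζ) r := by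
        rcases hy' with h' | h'
        · exact absurd h' hyR
        · exact h'
      have hyH : y ∈ extHullR ends R ζ \ R := ⟨⟨r₀, hr₀, Or.inl hy⟩, hyR⟩
      have hzH : z ∈ extHullR ends R ζ \ R := ⟨⟨r₀, hr₀, Or.inl hz⟩, hzR⟩
      have harm := armR_eq_of_edge hyz' hyH hzH
      refine Or.inr ⟨r, hr, ?_⟩
      rw [harm]
      have he' : insideConfig ends (armR ends R ζ y ∪ {r}) ζ e = true := by
        rw [insideConfig_eq_true_iff]
        refine ⟨he, y, Or.inl (mem_armR_self y), z, Or.inl ?_, hyz'⟩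
        rw [← harm]; exact mem_armR_self z
      exact mem_cluster_of_edge hyr he' hyz'
  rcases key.2 with hxR' | h'
  · exact absurd hxR' hxR
  · exact h'

omit [Fintype E] [DecidableEq E] hne in
/-- **Every blue-part vertex is blue-connected inside its arm to a root.** -/
theorem exists_root_conn_inside_blue {x : V} (hx : x ∈ bluePartR ends R ζ) :
    ∃ r ∈ R, x ∈ cluster ends (insideConfig ends (armR ends R ζ x ∪ {r}) (blue ζ)) r := by
  obtain ⟨⟨r₀, hr₀, hx₀⟩, hxR⟩ := hx
  have key : x ∈ {y | y ∈ cluster ends (blue ζ) r₀ ∧ (y ∈ R ∨ ∃ r ∈ R,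
      y ∈ cluster ends (insideConfig ends (armR ends R ζ y ∪ {r}) (blue ζ)) r)} := by
    refine mem_of_conn_of_closed (ends := ends) (ω := blue ζ) ?_
      ⟨mem_cluster_self _ _ _, Or.inl hr₀⟩ hx₀
    rintro y ⟨hy, hy'⟩ z hyz
    obtain ⟨-, e, he, hyz'⟩ := exists_edge_of_adj hyz
    have hz : z ∈ cluster ends (blue ζ) r₀ := mem_cluster_of_edge hy he hyz'
    refine ⟨hz, ?_⟩
    by_cases hzR : z ∈ R
    · exact Or.inl hzR
    by_cases hyR : y ∈ R
    · refine Or.inr ⟨y, hyR, ?_⟩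
      have he' : insideConfig ends (armR ends R ζ z ∪ {y}) (blue ζ) e = true := by
        rw [insideConfig_eq_true_iff]
        exact ⟨he, y, Or.inr rfl, z, Or.inl (mem_armR_self z), hyz'⟩
      exact mem_cluster_of_edge (mem_cluster_self _ _ _) he' hyz'
    · obtain ⟨r, hr, hyr⟩ : ∃ r ∈ R,
          y ∈ cluster ends (insideConfig ends (armR ends R ζ y ∪ {r}) (blue ζ)) r := by
        rcases hy' with h' | h'
        · exact absurd h' hyR
        · exact h'
      have hyH : y ∈ extHullR ends R ζ \ R := ⟨⟨r₀, hr₀, Or.inr hy⟩, hyR⟩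
      have hzH : z ∈ extHullR ends R ζ \ R := ⟨⟨r₀, hr₀, Or.inr hz⟩, hzR⟩
      have harm := armR_eq_of_edge hyz' hyH hzH
      refine Or.inr ⟨r, hr, ?_⟩
      rw [harm]
      have he' : insideConfig ends (armR ends R ζ y ∪ {r}) (blue ζ) e = true := by
        rw [insideConfig_eq_true_iff]
        refine ⟨he, y, Or.inl (mem_armR_self y), z, Or.inl ?_, hyz'⟩
        rw [← harm]; exact mem_armR_self z
      exact mem_cluster_of_edge hyr he' hyz'
  rcases key.2 with hxR' | h'
  · exact absurd hxR' hxR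
  · exact h'

end NonEscaping

end LocRows

end Summit.Ventures.PercRepro2
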